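import Mathlib
import Literature.Probability.LatticeModels.TorusGreenHeatKernel
import Literature.MathematicalPhysics.QuantumFieldTheory.Balaban1983to89.TreeLengthTorus

/-!
# T⁴ programme, node NE3 (η-rate of the minimisers) — THE FLAT RUNG, part 10: the scalar FREE massive kernel on a torus
# `(ℤ/P)^D` — character sum, lattice equation `(−Δ + m²)f = δ`, and the heat (Laplace) representation
# `f(z) = ∫₀^∞ e^{−m²t} Π_i q^P_{2t}(z_i) dt`

Fifteenth generation of the NE3 prover lineage P1 of the cell `pub-balaban`, file 4 of the free-gradient chain
(`SliceFlatHeatOneDim → SliceFlatHeatWeighted → SliceFlatHeatTorus → SliceFlatFreeKernel → SliceFlatFreeResolvent →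
SliceFlatGradient`; end point: the flat `hT31` item 1 of the lineage's one type p199789).  THIS FILE is pure finite Fourier
analysis on the torus `(ℤ/P)^D` (tree `TorusFourierProofs.torusChar`, `sum_torusChar_left`, `TorusFourier.dispersion ∕
latticeMomentum`, `TorusGreenHeatKernel.prod_torusHeatKernel_eq_sum`):
 * §1 the character sum `charSum m² z = Σ_k χ_k(z)/(2ε(p_k) + m²)`, the scalar kernel `freeKer m² z = Re charSum / P^D` and the
   LATTICE EQUATION `Σ_ν [2f(z) − f(z+e_ν) − f(z−e_ν)] + m²f(z) = 𝟙[z = 0]` (`freeKer_laplace`);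
 * §2 the HEAT REPRESENTATION `freeKer m² z = ∫₀^∞ e^{−m²t}·Π_i q^P_{2t}(z_i) dt` for `m² > 0` (`freeKer_eq_integral`; mode by
   mode `(2ε + m²)⁻¹ = ∫₀^∞ e^{−(m²+2ε)t}dt`).
Part 11 (`SliceFlatFreeResolvent`) lifts `freeKer n⁻²` to the NE3 carrier as the inverse of `stencilE + n⁻²·1` and bounds its unit
row differences block by block.  Nothing here is specific to a gauge theory.

Honest framing: finite-T⁴ ultraviolet bookkeeping about MINIMISERS (rung (B)+1 of the cell's ladder); no conditional of the
cell (`BetaPertH`, (B), (B^μ)) is used or hidden; nothing bears on infinite volume, a mass gap, or the Clay problem; NE3 is NOT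
proved by this file.  ABSOLUTE RULE of the cell kept: inputs are Mathlib and kernel-proved tree modules only (the `LatticeModels`
torus Fourier ∕ heat-kernel files after Lawler–Limic 2010, Friedli–Velenik §10.4 conventions); every declaration is a [model]
definition or a [folklore] theorem; no `def … : Prop`, no `sorry`, no axioms beyond Mathlib's.  PLACEMENT (human rule
2026-08-19): cell work under `Summits/QuantumFields/BalabanUV/`; moves nothing.  Records: `t4/T4-EST-U1b-OSC.md` v1.32,
`t4/T4-EST-NE3-P1.md` v2.31 of the cell `pub-balaban`.
-/

noncomputable section

open Real Finset Filter MeasureTheory Set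

namespace Summit.QuantumFields.BalabanUV.T4Continuum.SliceFlatFreeKernel

open scoped ComplexConjugate
open Literature.Probability.LatticeModels
open Literature.MathematicalPhysics.QuantumFieldTheory.Balaban1983to89.TreeLengthTorus (TPt)

/-! ## §1  The scalar free kernel on `(ℤ/P)^D` via characters, and its lattice equation -/
section Scalar

variable {D P : ℕ} [NeZero P]

/-- The symbol `2ε(p_k) + m²` of `−Δ + m²` on the torus (`ε = Σ_i(1 − cos p_i)`, tree `TorusFourier.dispersion`). [folklore] -/
def symb (m2 : ℝ) (k : TPt D P) : ℝ := 2 * dispersion (latticeMomentum P k) + m2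

omit [NeZero P] in
/-- The symbol is positive for `m² > 0`. [folklore] -/
theorem symb_pos {m2 : ℝ} (hm : 0 < m2) (k : TPt D P) : 0 < symb m2 k := by
  unfold symb; linarith [dispersion_nonneg (latticeMomentum P k)]

/-- The character sum `Σ_k χ_k(z)/(2ε(p_k) + m²)`. [folklore] -/
def charSum (m2 : ℝ) (z : TPt D P) : ℂ := ∑ k : TPt D P, torusChar k z * (((symb m2 k)⁻¹ : ℝ) : ℂ)

/-- **The scalar free kernel** `freeKer m² z = P^{−D}·Re Σ_k χ_k(z)/(2ε(p_k) + m²)` — the kernel of `(−Δ + m²)⁻¹` on the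
torus `(ℤ/P)^D`. [model] [folklore] -/
def freeKer (m2 : ℝ) (z : TPt D P) : ℝ := (charSum m2 z).re / (P : ℝ) ^ D

/-- `e(κ) + conj e(κ) = 2cos(2πκ/P)` as a complex number. [folklore] -/
theorem stdAddChar_add_conj (κ : ZMod P) :
    (ZMod.stdAddChar κ : ℂ) + conj (ZMod.stdAddChar κ : ℂ) = ((2 * Real.cos (2 * π * (κ.val : ℝ) / P) : ℝ) : ℂ) := by
  rw [Complex.add_conj, re_stdAddChar]

/-- The one-mode identity behind the lattice equation: `Σ_ν (2 − e(k_ν) − conj e(k_ν)) + m² = 2ε(p_k) + m²`. [folklore] -/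
theorem sum_two_sub_char_eq_symb (m2 : ℝ) (k : TPt D P) :
    ∑ ν : Fin D, ((2 : ℂ) - (ZMod.stdAddChar (k ν) : ℂ) - conj (ZMod.stdAddChar (k ν) : ℂ)) + (m2 : ℂ)
      = ((symb m2 k : ℝ) : ℂ) := by
  have h : ∀ ν : Fin D, ((2 : ℂ) - (ZMod.stdAddChar (k ν) : ℂ) - conj (ZMod.stdAddChar (k ν) : ℂ))
      = ((2 * (1 - Real.cos (latticeMomentum P k ν)) : ℝ) : ℂ) := by
    intro ν
    have e : (2 : ℂ) - (ZMod.stdAddChar (k ν) : ℂ) - conj (ZMod.stdAddChar (k ν) : ℂ)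
        = 2 - ((ZMod.stdAddChar (k ν) : ℂ) + conj (ZMod.stdAddChar (k ν) : ℂ)) := by ring
    rw [e, stdAddChar_add_conj]
    simp only [latticeMomentum]
    push_cast; ring
  simp_rw [h]
  rw [symb, dispersion, Finset.mul_sum]
  push_cast
  rfl

/-- **The lattice equation for the character sum**: `Σ_ν [2S(z) − S(z+e_ν) − S(z−e_ν)] + m²S(z) = P^D·𝟙[z = 0]`. [folklore] -/
theorem charSum_laplace {m2 : ℝ} (hm : 0 < m2) (z : TPt D P) :
    ∑ ν : Fin D, (2 * charSum m2 z - charSum m2 (z + Pi.single ν 1) - charSum m2 (z - Pi.single ν 1))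
        + (m2 : ℂ) * charSum m2 z = if z = 0 then (P : ℂ) ^ D else 0 := by
  rw [← sum_torusChar_left z]
  -- per mode
  have hmode : ∀ kk : TPt D P,
      ∑ ν : Fin D, (2 * (torusChar kk z * (((symb m2 kk)⁻¹ : ℝ) : ℂ))
          - torusChar kk (z + Pi.single ν 1) * (((symb m2 kk)⁻¹ : ℝ) : ℂ)
          - torusChar kk (z - Pi.single ν 1) * (((symb m2 kk)⁻¹ : ℝ) : ℂ))
        + (m2 : ℂ) * (torusChar kk z * (((symb m2 kk)⁻¹ : ℝ) : ℂ)) = torusChar kk z := by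
    intro kk
    have hs : ((symb m2 kk : ℝ) : ℂ) ≠ 0 := by exact_mod_cast (symb_pos hm kk).ne'
    simp_rw [torusChar_add_right, torusChar_sub_right, torusChar_single_eq_stdAddChar]
    have hfac : ∑ ν : Fin D, (2 * (torusChar kk z * (((symb m2 kk)⁻¹ : ℝ) : ℂ))
          - torusChar kk z * (ZMod.stdAddChar (kk ν) : ℂ) * (((symb m2 kk)⁻¹ : ℝ) : ℂ)
          - torusChar kk z * conj (ZMod.stdAddChar (kk ν) : ℂ) * (((symb m2 kk)⁻¹ : ℝ) : ℂ))
        + (m2 : ℂ) * (torusChar kk z * (((symb m2 kk)⁻¹ : ℝ) : ℂ))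
        = torusChar kk z * (((symb m2 kk)⁻¹ : ℝ) : ℂ) *
          (∑ ν : Fin D, ((2 : ℂ) - (ZMod.stdAddChar (kk ν) : ℂ) - conj (ZMod.stdAddChar (kk ν) : ℂ)) + (m2 : ℂ)) := by
      rw [mul_add, Finset.mul_sum]
      congr 1
      · exact Finset.sum_congr rfl fun ν _ => by ring
      · ring
    rw [hfac, sum_two_sub_char_eq_symb, Complex.ofReal_inv, mul_assoc, inv_mul_cancel₀ hs, mul_one]
  unfold charSum
  rw [← Finset.sum_congr rfl fun kk _ => hmode kk, Finset.sum_add_distrib]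
  congr 1
  · rw [Finset.sum_comm]
    refine Finset.sum_congr rfl fun ν _ => ?_
    rw [Finset.mul_sum, ← Finset.sum_sub_distrib, ← Finset.sum_sub_distrib]
  · rw [Finset.mul_sum]

/-- **The lattice equation for the free kernel**: `Σ_ν [2f(z) − f(z+e_ν) − f(z−e_ν)] + m²f(z) = 𝟙[z = 0]` (`m² > 0`). [folklore] -/
theorem freeKer_laplace {m2 : ℝ} (hm : 0 < m2) (z : TPt D P) :
    ∑ ν : Fin D, (2 * freeKer m2 z - freeKer m2 (z + Pi.single ν 1) - freeKer m2 (z - Pi.single ν 1))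
        + m2 * freeKer m2 z = if z = 0 then 1 else 0 := by
  have h := congrArg Complex.re (charSum_laplace hm z)
  have hP : (0 : ℝ) < (P : ℝ) ^ D := pow_pos (by exact_mod_cast Nat.pos_of_ne_zero (NeZero.ne P)) D
  simp only [Complex.add_re, Complex.re_sum, Complex.sub_re, Complex.re_ofReal_mul] at h
  have h2 : ∀ w : ℂ, ((2 : ℂ) * w).re = 2 * w.re := fun w => by simp
  simp only [h2] at h
  unfold freeKer
  have hsplit : ∑ ν : Fin D, (2 * ((charSum m2 z).re / (P : ℝ) ^ D) - (charSum m2 (z + Pi.single ν 1)).re / (P : ℝ) ^ D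
        - (charSum m2 (z - Pi.single ν 1)).re / (P : ℝ) ^ D) + m2 * ((charSum m2 z).re / (P : ℝ) ^ D)
      = (∑ ν : Fin D, (2 * (charSum m2 z).re - (charSum m2 (z + Pi.single ν 1)).re - (charSum m2 (z - Pi.single ν 1)).re)
          + m2 * (charSum m2 z).re) / (P : ℝ) ^ D := by
    rw [add_div, Finset.sum_div]
    congr 1
    · exact Finset.sum_congr rfl fun ν _ => by ring
    · ring
  rw [hsplit, h]
  split_ifs with hz
  · rw [← Complex.ofReal_natCast, ← Complex.ofReal_pow, Complex.ofReal_re, div_self hP.ne']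
  · simp

end Scalar

/-! ## §2  The heat (Laplace) representation of the free kernel -/
section Heat

variable {D P : ℕ} [NeZero P]

/-- `∫₀^∞ e^{−ct} dt = c⁻¹` for `c > 0`. [folklore] -/
theorem integral_exp_neg_mul_Ioi {c : ℝ} (hc : 0 < c) : ∫ t in Ioi (0 : ℝ), Real.exp (-(c * t)) = c⁻¹ := by
  have h := integral_exp_mul_Ioi (a := -c) (by linarith) 0
  simp only [mul_zero, Real.exp_zero, neg_mul] at h
  rw [h]; field_simp

/-- **HEAT REPRESENTATION**: `freeKer m² z = ∫₀^∞ e^{−m²t}·Π_i q^P_{2t}(z_i) dt` for `m² > 0` (mode by mode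
`(2ε + m²)⁻¹ = ∫₀^∞ e^{−(m²+2ε)t}dt`, and `Π_i q^P_{2t}(z_i) = P^{−D}Σ_k cos(p_k·z)e^{−2tε(p_k)}` from the tree). [folklore] -/
theorem freeKer_eq_integral {m2 : ℝ} (hm : 0 < m2) (z : TPt D P) :
    freeKer m2 z = ∫ t in Ioi (0 : ℝ), Real.exp (-(m2 * t)) * ∏ i, torusHeatKernel (2 * t) (z i) := by
  have hP : (0 : ℝ) < (P : ℝ) ^ D := pow_pos (by exact_mod_cast Nat.pos_of_ne_zero (NeZero.ne P)) D
  -- the integrand, mode by mode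
  have hint : ∀ kk : TPt D P, IntegrableOn (fun t : ℝ => Real.exp (-(m2 * t)) *
      (Real.cos (∑ i, latticeMomentum P kk i * ((z i).val : ℝ)) *
        Real.exp (-(2 * t * dispersion (latticeMomentum P kk))))) (Ioi 0) := by
    intro kk
    have hc : 0 < m2 + 2 * dispersion (latticeMomentum P kk) := by linarith [dispersion_nonneg (latticeMomentum P kk)]
    have h0 : IntegrableOn (fun t : ℝ => Real.cos (∑ i, latticeMomentum P kk i * ((z i).val : ℝ)) *
        Real.exp (-(m2 + 2 * dispersion (latticeMomentum P kk)) * t)) (Ioi 0) :=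
      (exp_neg_integrableOn_Ioi 0 hc).const_mul (Real.cos (∑ i, latticeMomentum P kk i * ((z i).val : ℝ)))
    refine h0.congr_fun (fun t _ => ?_) measurableSet_Ioi
    simp only
    rw [show -(m2 + 2 * dispersion (latticeMomentum P kk)) * t = -(m2 * t) + -(2 * t * dispersion (latticeMomentum P kk))
      by ring, Real.exp_add]; ring
  have hmode : ∀ kk : TPt D P, ∫ t in Ioi (0 : ℝ), Real.exp (-(m2 * t)) *
      (Real.cos (∑ i, latticeMomentum P kk i * ((z i).val : ℝ)) * Real.exp (-(2 * t * dispersion (latticeMomentum P kk))))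
      = Real.cos (∑ i, latticeMomentum P kk i * ((z i).val : ℝ)) * (symb m2 kk)⁻¹ := by
    intro kk
    have hc : 0 < m2 + 2 * dispersion (latticeMomentum P kk) := by linarith [dispersion_nonneg (latticeMomentum P kk)]
    have e : ∀ t : ℝ, Real.exp (-(m2 * t)) * (Real.cos (∑ i, latticeMomentum P kk i * ((z i).val : ℝ)) *
        Real.exp (-(2 * t * dispersion (latticeMomentum P kk))))
        = Real.cos (∑ i, latticeMomentum P kk i * ((z i).val : ℝ)) *
          Real.exp (-((m2 + 2 * dispersion (latticeMomentum P kk)) * t)) := by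
      intro t
      rw [show -((m2 + 2 * dispersion (latticeMomentum P kk)) * t) = -(m2 * t) + -(2 * t * dispersion (latticeMomentum P kk))
        by ring, Real.exp_add]; ring
    simp_rw [e]
    rw [integral_const_mul, integral_exp_neg_mul_Ioi hc, symb, add_comm]
  -- assemble
  calc freeKer m2 z = (∑ kk : TPt D P, Real.cos (∑ i, latticeMomentum P kk i * ((z i).val : ℝ)) * (symb m2 kk)⁻¹)
        / (P : ℝ) ^ D := by
        unfold freeKer charSum
        rw [Complex.re_sum]
        congr 1
        refine Finset.sum_congr rfl fun kk _ => ?_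
        rw [Complex.re_mul_ofReal, torusChar_re]
    _ = (∑ kk : TPt D P, ∫ t in Ioi (0 : ℝ), Real.exp (-(m2 * t)) *
          (Real.cos (∑ i, latticeMomentum P kk i * ((z i).val : ℝ)) *
            Real.exp (-(2 * t * dispersion (latticeMomentum P kk))))) / (P : ℝ) ^ D := by
        rw [Finset.sum_congr rfl fun kk _ => (hmode kk).symm]
    _ = (∫ t in Ioi (0 : ℝ), ∑ kk : TPt D P, Real.exp (-(m2 * t)) *
          (Real.cos (∑ i, latticeMomentum P kk i * ((z i).val : ℝ)) *
            Real.exp (-(2 * t * dispersion (latticeMomentum P kk))))) / (P : ℝ) ^ D := by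
        rw [integral_finsetSum _ fun kk _ => hint kk]
    _ = ∫ t in Ioi (0 : ℝ), Real.exp (-(m2 * t)) * ∏ i, torusHeatKernel (2 * t) (z i) := by
        rw [div_eq_mul_inv, ← integral_mul_const]
        refine setIntegral_congr_fun measurableSet_Ioi fun t _ => ?_
        rw [prod_torusHeatKernel_eq_sum, ← Finset.mul_sum, div_eq_mul_inv]
        simp only [mul_assoc]

end Heat

end Summit.QuantumFields.BalabanUV.T4Continuum.SliceFlatFreeKernel
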